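import Summits.NavierStokesRegularity.NavierStokesRegularity.Theorems.ExtremiserTransienceKStarAttainedContact
import HarnessLib

/-!
# Route `ExtremiserTransience`, support item `KStarAttained` (stmt-NavierStokesRegularity-24370):
# THE PLATEAU OF AN ATTAINER IS A PROPER COMPACT-CLOSURE REGION WHOSE BOUNDARY CARRIES NON-ANALYTIC POINTS

`--supports stmt-NavierStokesRegularity-24370`. Author: prover seat `ns-et-p1` (g3).

Refinement of `…KStarAttainedContact`. Let `(v, M, B)` be admissible (`‖v‖ ≤ M`), non-degenerate, and ATTAIN
`κ⋆`; write `K = {x : ‖v x‖ = M}` (contact set) and `W = interior K` (the speed plateau, nonempty by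
`KStar.interior_contact_nonempty`).

* `KStar.contact_isCompact` — `K` is compact (closed, and bounded because `v → 0` at infinity and `M > 0`);
* `KStar.frontier_plateau_nonempty` — `W` is a nonempty open set with compact closure in the connected space
  `ℝ³`, hence not clopen: its boundary `∂W` is nonempty;
* `KStar.not_analyticOnNhd_ball_of_mem_frontier` — **at every boundary point `x ∈ ∂W` the field `v` is
  real-analytic on NO ball around `x`**: were `v` analytic on `B(x,r)`, the analytic function `‖v‖²` would be
  `≡ M²` near a point of `W ∩ B(x,r)`, hence on the whole (connected) ball by the identity principle, putting
  `B(x,r)` inside `K`, i.e. `x ∈ interior K = W` — but `W` is open and `x ∈ ∂W`.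
* `KStar.exists_nonanalytic_point` — hence an attainer has a point with no analytic neighbourhood.

So the free boundary of the obstacle `|v| ≤ M` is a genuine analytic singular set of any extremiser: the
Euler–Lagrange system (`…KStarAttainedEulerLagrange`, elliptic of order four off `K`) cannot be continued
analytically across it. The item (existence of such a `C^∞` object) is not decided; nothing about Navier–Stokes
solutions; NS regularity is NOT proved by anything here. [folklore]
-/

noncomputable section

open Set Filter Topology MeasureTheory Metric
open scoped InnerProductSpace RealInnerProductSpace ENNReal NNReal ContDiff
open Literature.Analysis.FluidPDE

namespace Summit.NavierStokesRegularity.NavierStokesRegularity.Theorems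

-- the problem directory repeats the summit name (`NavierStokesRegularity/NavierStokesRegularity`)
set_option linter.dupNamespace false

namespace DepletionLadder.KStar

variable {v : EuclideanSpace ℝ (Fin 3) → EuclideanSpace ℝ (Fin 3)}

/-- **The contact set of an admissible field with `M > 0` is compact**: it is closed (`‖v‖` is continuous) and
bounded (`‖v‖ < M/2` off a large ball, `exists_radius_norm_lt`). [folklore] -/
theorem contact_isCompact (hv : ContDiff ℝ ∞ v) {M B : ℝ} (hMpos : 0 < M) (hB : ∀ x, ‖fderiv ℝ v x‖ ≤ B)
    (h0 : ∫⁻ x, ‖iteratedFDeriv ℝ 0 v x‖ₑ ^ 2 < ⊤) : IsCompact {x | ‖v x‖ = M} := by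
  obtain ⟨R, -, hR⟩ := exists_radius_norm_lt hv hB h0 (half_pos hMpos)
  refine isCompact_of_isClosed_isBounded (isClosed_eq (continuous_norm.comp hv.continuous) continuous_const)
    ((isBounded_closedBall (x := (0 : EuclideanSpace ℝ (Fin 3))) (r := R)).subset fun x hx => ?_)
  rw [mem_closedBall, dist_zero_right]
  by_contra h
  have := hR x (le_of_not_ge h)
  rw [mem_setOf_eq] at hx
  linarith

/-- **At a boundary point of the plateau, `v` is analytic on no ball.** For any field `v` and level `M`, if
`x ∈ ∂(interior {‖v‖ = M})` then for every `r > 0`, `v` is not real-analytic on `B(x, r)` (identity principle for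
`‖v‖²` on the connected ball). [folklore] -/
theorem not_analyticOnNhd_ball_of_mem_frontier {M : ℝ} {x : EuclideanSpace ℝ (Fin 3)}
    (hx : x ∈ frontier (interior {y | ‖v y‖ = M})) {r : ℝ} (hr : 0 < r) :
    ¬ AnalyticOnNhd ℝ v (ball x r) := by
  intro han
  -- `‖v‖²` is analytic on the ball
  have hsq : AnalyticOnNhd ℝ (fun y => ‖v y‖ ^ 2) (ball x r) := by
    have hcoord : ∀ i : Fin 3, AnalyticOnNhd ℝ (fun y => v y i) (ball x r) := fun i =>
      (EuclideanSpace.proj i : EuclideanSpace ℝ (Fin 3) →L[ℝ] ℝ).comp_analyticOnNhd han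
    have heq : (fun y => ‖v y‖ ^ 2) = fun y => ∑ i, v y i * v y i := by
      funext y
      rw [EuclideanSpace.norm_eq, Real.sq_sqrt (Finset.sum_nonneg fun i _ => sq_nonneg _)]
      exact Finset.sum_congr rfl fun i _ => by rw [Real.norm_eq_abs, sq_abs, sq]
    rw [heq]
    exact Finset.analyticOnNhd_fun_sum _ fun i _ => (hcoord i).mul (hcoord i)
  -- a point of the plateau inside the ball
  have hxcl : x ∈ closure (interior {y | ‖v y‖ = M}) := frontier_subset_closure hx
  obtain ⟨z₀, hz₀B, hz₀W⟩ : (ball x r ∩ interior {y | ‖v y‖ = M}).Nonempty :=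
    mem_closure_iff_nhds.1 hxcl (ball x r) (ball_mem_nhds x hr) |>.imp fun z hz => ⟨hz.1, hz.2⟩
  -- `‖v‖² = M²` near `z₀`, hence on the whole ball
  have hev : (fun y => ‖v y‖ ^ 2) =ᶠ[𝓝 z₀] fun _ => M ^ 2 := by
    filter_upwards [isOpen_interior.mem_nhds hz₀W] with y hy
    have hy' := interior_subset hy
    simp only [mem_setOf_eq] at hy'
    rw [hy']
  have hball : EqOn (fun y => ‖v y‖ ^ 2) (fun _ => M ^ 2) (ball x r) :=
    hsq.eqOn_of_preconnected_of_eventuallyEq analyticOnNhd_const (convex_ball x r).isPreconnected hz₀B hev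
  -- so the ball lies in the contact set, and `x` in its interior: contradiction with `x ∈ ∂W`, `W` open
  have hM0 : 0 ≤ M := by
    have hz := interior_subset hz₀W
    simp only [mem_setOf_eq] at hz
    rw [← hz]; exact norm_nonneg _
  have hsub : ball x r ⊆ {y | ‖v y‖ = M} := fun y hy => by
    have h := hball hy
    simp only at h
    rw [mem_setOf_eq]
    nlinarith [norm_nonneg (v y)]
  have hxW : x ∈ interior {y | ‖v y‖ = M} :=
    interior_mono hsub (by rw [interior_eq_iff_isOpen.2 isOpen_ball]; exact mem_ball_self hr)
  have hxnot : x ∉ interior {y | ‖v y‖ = M} := by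
    have h := hx.2
    rwa [interior_interior] at h
  exact hxnot hxW

/-- **The plateau of an attainer has nonempty boundary.** For `(v, M, B)` admissible, non-degenerate and
attaining `κ⋆`, the plateau `W = interior {‖v‖ = M}` is nonempty (`interior_contact_nonempty`), open, and not all
of `ℝ³` (the contact set is compact), so in the connected space `ℝ³` it is not clopen: `∂W ≠ ∅`. [folklore] -/
theorem frontier_plateau_nonempty (hv : ContDiff ℝ ∞ v) (hdiv : VectorCalculus.IsDivFree v) {M B : ℝ}
    (hM : ∀ x, ‖v x‖ ≤ M) (hB : ∀ x, ‖fderiv ℝ v x‖ ≤ B) (h0 : ∫⁻ x, ‖iteratedFDeriv ℝ 0 v x‖ₑ ^ 2 < ⊤)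
    (h1 : ∫⁻ x, ‖iteratedFDeriv ℝ 1 v x‖ₑ ^ 2 < ⊤) (h2 : ∫⁻ x, ‖iteratedFDeriv ℝ 2 v x‖ₑ ^ 2 < ⊤)
    (hpos : 0 < M * Real.sqrt (∫ x, ‖curl v x‖ ^ 2) * Real.sqrt (∫ x, frobeniusNormSq (fderiv ℝ (curl v) x)))
    (hatt : |∫ x, ⟪curl v x, fderiv ℝ v x (curl v x)⟫| =
      sInf {κ : ℝ | (∀ (v : EuclideanSpace ℝ (Fin 3) → EuclideanSpace ℝ (Fin 3)) (M B : ℝ), ContDiff ℝ (⊤ : ℕ∞) v → Literature.Analysis.FluidPDE.VectorCalculus.IsDivFree v → (∀ x, ‖v x‖ ≤ M) → (∀ x, ‖fderiv ℝ v x‖ ≤ B) → (∫⁻ x, ‖iteratedFDeriv ℝ 0 v x‖ₑ ^ 2 < ⊤) → (∫⁻ x, ‖iteratedFDeriv ℝ 1 v x‖ₑ ^ 2 < ⊤) → (∫⁻ x, ‖iteratedFDeriv ℝ 2 v x‖ₑ ^ 2 < ⊤) → |∫ x, ⟪Literature.Analysis.FluidPDE.curl v x, fderiv ℝ v x (Literature.Analysis.FluidPDE.curl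 v x)⟫_ℝ| ≤ κ * M * Real.sqrt (∫ x, ‖Literature.Analysis.FluidPDE.curl v x‖ ^ 2) * Real.sqrt (∫ x, Literature.Analysis.FluidPDE.frobeniusNormSq (fderiv ℝ (Literature.Analysis.FluidPDE.curl v) x)))} * M * Real.sqrt (∫ x, ‖curl v x‖ ^ 2) *
        Real.sqrt (∫ x, frobeniusNormSq (fderiv ℝ (curl v) x))) :
    (frontier (interior {x | ‖v x‖ = M})).Nonempty := by
  have hW := interior_contact_nonempty hv hdiv hM hB h0 h1 h2 hpos hatt
  have hM0 : 0 ≤ M := (norm_nonneg _).trans (hM 0)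
  have hMpos : 0 < M := by
    rcases hM0.eq_or_lt with h | h
    · rw [← h, zero_mul, zero_mul] at hpos; exact absurd hpos (lt_irrefl _)
    · exact h
  -- `W ≠ univ`: some far point has `‖v‖ < M/2`
  obtain ⟨R, -, hR⟩ := exists_radius_norm_lt hv hB h0 (half_pos hMpos)
  obtain ⟨y, hy⟩ := NormedSpace.exists_lt_norm ℝ (EuclideanSpace ℝ (Fin 3)) R
  have hyW : y ∉ interior {x | ‖v x‖ = M} := fun h => by
    have h' := interior_subset h
    simp only [mem_setOf_eq] at h'
    have := hR y hy.le
    linarith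
  by_contra hfr
  rw [not_nonempty_iff_eq_empty, ← isClopen_iff_frontier_eq_empty] at hfr
  rcases isClopen_iff.1 hfr with h | h
  · exact absurd h hW.ne_empty
  · exact hyW (h ▸ mem_univ y)

/-- **An attainer of `κ⋆` has a point with no real-analytic neighbourhood** (any boundary point of its speed
plateau). In particular it is not real-analytic on `ℝ³` (cf. `not_attained_of_analyticOnNhd`). [folklore] -/
theorem exists_nonanalytic_point (hv : ContDiff ℝ ∞ v) (hdiv : VectorCalculus.IsDivFree v) {M B : ℝ}
    (hM : ∀ x, ‖v x‖ ≤ M) (hB : ∀ x, ‖fderiv ℝ v x‖ ≤ B) (h0 : ∫⁻ x, ‖iteratedFDeriv ℝ 0 v x‖ₑ ^ 2 < ⊤)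
    (h1 : ∫⁻ x, ‖iteratedFDeriv ℝ 1 v x‖ₑ ^ 2 < ⊤) (h2 : ∫⁻ x, ‖iteratedFDeriv ℝ 2 v x‖ₑ ^ 2 < ⊤)
    (hpos : 0 < M * Real.sqrt (∫ x, ‖curl v x‖ ^ 2) * Real.sqrt (∫ x, frobeniusNormSq (fderiv ℝ (curl v) x)))
    (hatt : |∫ x, ⟪curl v x, fderiv ℝ v x (curl v x)⟫| =
      sInf {κ : ℝ | (∀ (v : EuclideanSpace ℝ (Fin 3) → EuclideanSpace ℝ (Fin 3)) (M B : ℝ), ContDiff ℝ (⊤ : ℕ∞) v → Literature.Analysis.FluidPDE.VectorCalculus.IsDivFree v → (∀ x, ‖v x‖ ≤ M) → (∀ x, ‖fderiv ℝ v x‖ ≤ B) → (∫⁻ x, ‖iteratedFDeriv ℝ 0 v x‖ₑ ^ 2 < ⊤) → (∫⁻ x, ‖iteratedFDeriv ℝ 1 v x‖ₑ ^ 2 < ⊤) → (∫⁻ x, ‖iteratedFDeriv ℝ 2 v x‖ₑ ^ 2 < ⊤) → |∫ x, ⟪Literature.Analysis.FluidPDE.curl v x, fderiv ℝ v x (Literature.Analysis.FluidPDE.curl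 v x)⟫_ℝ| ≤ κ * M * Real.sqrt (∫ x, ‖Literature.Analysis.FluidPDE.curl v x‖ ^ 2) * Real.sqrt (∫ x, Literature.Analysis.FluidPDE.frobeniusNormSq (fderiv ℝ (Literature.Analysis.FluidPDE.curl v) x)))} * M * Real.sqrt (∫ x, ‖curl v x‖ ^ 2) *
        Real.sqrt (∫ x, frobeniusNormSq (fderiv ℝ (curl v) x))) :
    ∃ x : EuclideanSpace ℝ (Fin 3), ‖v x‖ = M ∧ ∀ r : ℝ, 0 < r → ¬ AnalyticOnNhd ℝ v (ball x r) := by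
  obtain ⟨x, hx⟩ := frontier_plateau_nonempty hv hdiv hM hB h0 h1 h2 hpos hatt
  refine ⟨x, ?_, fun r hr => not_analyticOnNhd_ball_of_mem_frontier hx hr⟩
  -- boundary points of the plateau lie in the (closed) contact set
  have hcl : x ∈ closure {y | ‖v y‖ = M} := closure_mono interior_subset (frontier_subset_closure hx)
  have hK : IsClosed {y | ‖v y‖ = M} := isClosed_eq (continuous_norm.comp hv.continuous) continuous_const
  rw [hK.closure_eq] at hcl
  simpa only [mem_setOf_eq] using hcl

end DepletionLadder.KStar

end Summit.NavierStokesRegularity.NavierStokesRegularity.Theorems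

end
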